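import Literature.AnabelianGeometry.EtaleTheta.SettingModelChiTheta
import Literature.AnabelianGeometry.EtaleTheta.SettingModelChiDeltaTheta
import Literature.AnabelianGeometry.EtaleTheta.Discharge.Sec2CyclotomeModOfChi
import HarnessLib

/-!
# The χ-twisted root model of [EtTh] §1 (R78 (B)), row #5: the cyclotome identifications
# `μ_N ≅ (l·Δ_Θ) ⊗ ℤ/Nℤ` and a `CyclotomeTower` EXIST at `ThetaSetting.modelχ p` (non-vacuity of the §2 tower datum)

Mochizuki, *The Étale Theta Function …* [EtTh], Publ. RIMS **45** (2009), §1 p. 12 «(`Ẑ(1) ≅`) `Δ_Θ`»,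
§2 p. 46 «the natural isomorphism `μ_N ≅ (l·Δ_Θ) ⊗ (ℤ/Nℤ)`», Def. 2.13 (ii) p. 48, Cor. 2.19 (ii) p. 64
(PRIMS PDF pages).  Cell abc-iut, layer L2, seat abc-iut-L2-t8 (owner of the interfaces
`ThetaSetting.CyclotomeMod` / `CyclotomeTower`, `ThetaCyclotomes.lean` / `TowerOfSetting.lean`); R78 cluster
(L2-lead RULINGS #13 R100; integrator abc-iut-L6-d6) row #5 «t8 adapter layer at the χ-twisted model»;
GAP-LEDGER G-L2t10-1 («DATUM wanted: `Nonempty (D.CyclotomeTower l E)`»).  PROOF-ONLY (0 definitions).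

INPUTS, consumed BY NAME: abc-iut-L2-t1's `ThetaSetting.modelχ p` (F5b `SettingModelChiTheta.lean`:
`GtpTheta := CurveTheta.GTheta (curveχ p)`, `thetaToEll := CurveTheta.thetaToEll (curveχ p)`, so that
`(modelχ p).DeltaTheta` is DEFINITIONALLY `Ker(CurveTheta.thetaToEll (curveχ p))`); abc-iut-L6-d6's
`Ẑ`-coordinates on the theta centre (F1c `SettingModelChiDeltaTheta.lean`: `deltaThetaCoordχ p : Ẑ →* Δ_Θ`,
`t ↦ c^t`, `continuous_deltaThetaCoordχ`, `bijective_deltaThetaCoordχ`, and the χ-law `deltaThetaCoordχ_chi`: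
`c^{χ(aug^Θ g)·t} = g · c^t · g⁻¹`); abc-iut-w5-d091's cyclotomic character `SettingModel.chi p` (F3) through
this seat's `Discharge/Sec2CyclotomeModOfChi.lean` (`…_of_chiTwist_inv`).

RESULTS: `ThetaSetting.isCompact_deltaTheta_of_zHat_surjective` (generic) + `isCompact_deltaTheta_modelχ` (GAP G-w5d187-1's
binder `hΔ : IsCompact Δ_Θ` HOLDS at the model); `CurveTheta.isClosed_thetaKer` / `CurveTheta.t2Space_GTheta` (generic: `(Π^tp_X)^Θ` of EVERY
curve-based model is Hausdorff — `Ker(Π^tp_X ↠ (Π^tp_X)^Θ)` is the pull-back of a closure); and AT THE MODEL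
`modelχ p`, for every `l ≥ 1`: **`modelχ_exists_cyclotomeMod_family`** (identifications at ALL levels,
compatible with the power maps), **`modelχ_nonempty_cyclotomeMod`** (every level `N`),
**`modelχ_nonempty_cyclotomeTower`** (a `CyclotomeTower l E` over EVERY cofinal chain `E ∋ 1`) — the binder
`τ : D.CyclotomeTower l E` / `μ : D.CyclotomeMod l N` of the [EtTh]-§2-at-the-model theorems (`thetaEnvTower`,
Cor. 2.18/2.19 discharges, the L6 chains) is INHABITED at a theta setting satisfying `IsEtThOrigin`
(`modelχ_isEtThOrigin`), whereas at the root models `model p` / `model₂ p` it is provably EMPTY for `p² ∣ N`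
(abc-iut-w5-d125, trivial Galois action on `Δ_Θ` vs `galMuN_ne_one`).  HONEST LABEL: a semi-synthetic model —
consistency evidence for the typed interface, NOT the tempered fundamental group of a curve; nothing of
[EtTh] is asserted; no side is taken on [IUTchIII] Cor. 3.12; typed ≠ endorsed.
-/

noncomputable section

namespace Literature.AnabelianGeometry.EtaleTheta

open Literature.AnabelianGeometry.SemiGraphs
open CategoryTheory ProfiniteGrp ProfiniteGrp.ProfiniteCompletion

namespace CurveTheta

variable {p : ℕ} [Fact p.Prime] (X : TemperedCurve p)

/-- `Ker(Π^tp_X ↠ (Π^tp_X)^Θ) = toHat⁻¹([[Δ_X,Δ_X],Δ_X]⁻)` is CLOSED in `Π^tp_X` (pull-back of a closure along the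
continuous `Π^tp_X → Π_X`). [cite: MochizukiEtTh2009, §1 p.12] -/
theorem isClosed_thetaKer : IsClosed (thetaKer X : Set X.PiTemp) :=
  (Subgroup.isClosed_topologicalClosure _).preimage X.toHat.continuous

/-- Hence the theta quotient `(Π^tp_X)^Θ = Π^tp_X / Ker` of a curve-based model is HAUSDORFF ("a topological
group", p. 12). [cite: MochizukiEtTh2009, §1 p.12] -/
theorem t2Space_GTheta : T2Space (GTheta X) := by
  haveI : IsClosed (thetaKer X : Set X.PiTemp) := isClosed_thetaKer X
  infer_instance

end CurveTheta

namespace ThetaSetting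

variable {p : ℕ} [Fact p.Prime] (D : ThetaSetting p)

/-- If `Δ_Θ` is continuously parametrised ONTO by `Ẑ` (e.g. `t ↦ c^t` at the R78 models), then `Δ_Θ` is COMPACT
("`Δ_Θ (≅ Ẑ(1))` … profinite", p. 12) — the binder `hΔ : IsCompact Δ_Θ` of GAP-LEDGER G-w5d187-1 at such a
setting. [cite: MochizukiEtTh2009, §1 p.12] -/
theorem isCompact_deltaTheta_of_zHat_surjective
    (f : completion (GrpCat.of (Multiplicative ℤ)) →* ↥D.DeltaTheta) (hf : Continuous f)
    (hsurj : Function.Surjective f) : IsCompact (D.DeltaTheta : Set D.GtpTheta) := by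
  have hrange : Set.range (fun t => ((f t : ↥D.DeltaTheta) : D.GtpTheta)) = (D.DeltaTheta : Set D.GtpTheta) := by
    ext x
    constructor
    · rintro ⟨t, rfl⟩
      exact (f t).2
    · intro hx
      obtain ⟨t, ht⟩ := hsurj ⟨x, hx⟩
      exact ⟨t, by simp only [ht]⟩
  rw [← hrange]
  exact isCompact_range (continuous_subtype_val.comp hf)

end ThetaSetting

namespace SettingModel

variable (p : ℕ) [Fact p.Prime]

/-- `Δ_Θ` of the χ-twisted model is Hausdorff. [cite: MochizukiEtTh2009, §1 p.12] -/
theorem t2Space_deltaTheta_modelχ : T2Space ↥(ThetaSetting.modelχ p).DeltaTheta := by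
  haveI : T2Space (ThetaSetting.modelχ p).GtpTheta := CurveTheta.t2Space_GTheta (curveχ p)
  infer_instance

/-- **`Δ_Θ` of the χ-twisted model is COMPACT** (image of `Ẑ` under `t ↦ c^t`) — GAP-LEDGER G-w5d187-1's binder
`hΔ : IsCompact Δ_Θ` HOLDS at `modelχ`. [cite: MochizukiEtTh2009, §1 p.12] -/
theorem isCompact_deltaTheta_modelχ :
    IsCompact ((ThetaSetting.modelχ p).DeltaTheta : Set (ThetaSetting.modelχ p).GtpTheta) :=
  (ThetaSetting.modelχ p).isCompact_deltaTheta_of_zHat_surjective (deltaThetaCoordχ p)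
    (continuous_deltaThetaCoordχ p) (bijective_deltaThetaCoordχ p).2

/-- **The χ-law in the shape of `Sec2CyclotomeModOfTateTwist`**: for `g ∈ Π^tp_X` of the twisted model and
`t ∈ Ẑ`, `g · c^t · g⁻¹ = c^{χ(aug g)·t}` in `Δ_Θ` (abc-iut-L6-d6's `deltaThetaCoordχ_chi` at `toTheta g`, with
`aug^Θ ∘ toTheta = aug`). [cite: MochizukiEtTh2009, §1 p.12] -/
theorem conjNormal_toTheta_deltaThetaCoordχ (g : (ThetaSetting.modelχ p).PiTemp) (t : ZH) :
    MulAut.conjNormal ((ThetaSetting.modelχ p).toTheta g) (deltaThetaCoordχ p t) =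
      deltaThetaCoordχ p (chi p ((ThetaSetting.modelχ p).aug.toMonoidHom g) t) := by
  have h := deltaThetaCoordχ_chi p (CurveTheta.toTheta (curveχ p) g) t
  rw [CurveTheta.augTheta_toTheta] at h
  exact h.symm

/-- **`μ_N ≅ (l·Δ_Θ) ⊗ ℤ/Nℤ` at ALL levels, compatibly, AT THE χ-TWISTED MODEL** (`l ≥ 1`): a family
`mods N : (modelχ p).CyclotomeMod l N` with `(l·Δ_Θ ↠ μ_{M'} ↠ μ_M) = (l·Δ_Θ ↠ μ_M)` for every `M ∣ M'`.
[cite: MochizukiEtTh2009, Def 2.13 (ii) p.48] -/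
theorem modelχ_exists_cyclotomeMod_family {l : ℕ} (hl : 0 < l) :
    ∃ mods : ∀ N : ℕ+, (ThetaSetting.modelχ p).CyclotomeMod l N,
      ∀ (M M' : ℕ+) (h : (M : ℕ) ∣ (M' : ℕ)) (x : ↥((ThetaSetting.modelχ p).lDeltaTheta l)),
        MuN.red p M M' h ((mods M').red x) = (mods M).red x := by
  haveI := t2Space_deltaTheta_modelχ p
  exact (ThetaSetting.modelχ p).exists_cyclotomeMod_family_of_chiTwist_inv hl (deltaThetaCoordχ p)
    (continuous_deltaThetaCoordχ p) (bijective_deltaThetaCoordχ p) (conjNormal_toTheta_deltaThetaCoordχ p)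

/-- **`CyclotomeMod l N` is INHABITED at the χ-twisted model**, for every `l ≥ 1` and every level `N`.
[cite: MochizukiEtTh2009, Def 2.13 p.46] -/
theorem modelχ_nonempty_cyclotomeMod {l : ℕ} (hl : 0 < l) (N : ℕ+) :
    Nonempty ((ThetaSetting.modelχ p).CyclotomeMod l N) := by
  obtain ⟨mods, -⟩ := modelχ_exists_cyclotomeMod_family p hl
  exact ⟨mods N⟩

/-- **A `CyclotomeTower l E` EXISTS at the χ-twisted model** over EVERY cofinal chain `E ∋ 1` (`l ≥ 1`) — the
datum of GAP-LEDGER G-L2t10-1 is non-vacuous at a setting satisfying `IsEtThOrigin`.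
[cite: MochizukiEtTh2009, Cor 2.19 (ii) p.64] -/
theorem modelχ_nonempty_cyclotomeTower {l : ℕ} (hl : 0 < l) {E : Set ℕ+} (one_mem : (1 : ℕ+) ∈ E)
    (cofinal : ∀ n : ℕ+, ∃ M ∈ E, n ∣ M) (total : ∀ M ∈ E, ∀ M' ∈ E, M ∣ M' ∨ M' ∣ M) :
    Nonempty ((ThetaSetting.modelχ p).CyclotomeTower l E) := by
  haveI := t2Space_deltaTheta_modelχ p
  exact (ThetaSetting.modelχ p).nonempty_cyclotomeTower_of_chiTwist_inv hl (deltaThetaCoordχ p)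
    (continuous_deltaThetaCoordχ p) (bijective_deltaThetaCoordχ p) (conjNormal_toTheta_deltaThetaCoordχ p)
    one_mem cofinal total

/-- **Joint satisfiability** of the freeness guard and the cyclotome data: there is a theta setting which is an
EtTh-origin AND carries an identification `μ_N ≅ (l·Δ_Θ) ⊗ ℤ/Nℤ` at EVERY level `N` (so every
`(hO : D.IsEtThOrigin) (μ : D.CyclotomeMod l N)`-hypothesised theorem of the cell quantifies over a nonempty
domain). [cite: MochizukiEtTh2009, Cor 2.19 (ii) p.64] -/
theorem exists_isEtThOrigin_and_forall_nonempty_cyclotomeMod {l : ℕ} (hl : 0 < l) :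
    ∃ D : ThetaSetting p, D.IsEtThOrigin ∧ ∀ N : ℕ+, Nonempty (D.CyclotomeMod l N) :=
  ⟨ThetaSetting.modelχ p, ThetaSetting.modelχ_isEtThOrigin p, modelχ_nonempty_cyclotomeMod p hl⟩

/-- **JOINT SATISFIABILITY of the standing hypotheses of the §2 / [IUTchII]-side chains at ONE setting**: the
χ-twisted model is an EtTh-origin (F-2498 guard), satisfies the closedness binder `hYcl` (GAP G-w4d021-2), has
`Δ_Θ` COMPACT (GAP G-w5d187-1), `aug` OPEN (GAP G-L2t11-3 (c)), carries `CyclotomeMod l N` at EVERY level and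
a `CyclotomeTower l E` over every cofinal chain `E ∋ 1` (GAP G-L2t10-1) — for every `l ≥ 1`.  (The E-indexed
hypotheses — `EtaleThetaData`, `DoubleUnderline`, `Compat`, Prop. 1.5 — are the Kummer layer, R78 files F6/F7.)
[cite: MochizukiEtTh2009, Cor 2.19 (ii) p.64] -/
theorem exists_isEtThOrigin_and_hYcl_and_isCompact_and_cyclotomeTower {l : ℕ} (hl : 0 < l) {E : Set ℕ+}
    (one_mem : (1 : ℕ+) ∈ E) (cofinal : ∀ n : ℕ+, ∃ M ∈ E, n ∣ M)
    (total : ∀ M ∈ E, ∀ M' ∈ E, M ∣ M' ∨ M' ∣ M) :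
    ∃ D : ThetaSetting p, D.IsEtThOrigin ∧
      (D.DtpY.map D.toHat.toMonoidHom).topologicalClosure ≤
        D.DtpY.map D.toHat.toMonoidHom ⊔ (⁅⁅D.DeltaHat, D.DeltaHat⁆, D.DeltaHat⁆).topologicalClosure ∧
      IsCompact (D.DeltaTheta : Set D.GtpTheta) ∧ IsOpenMap D.aug ∧
      (∀ N : ℕ+, Nonempty (D.CyclotomeMod l N)) ∧ Nonempty (D.CyclotomeTower l E) :=
  ⟨ThetaSetting.modelχ p, ThetaSetting.modelχ_isEtThOrigin p, hYcl_modelχ p, isCompact_deltaTheta_modelχ p,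
    isOpenMap_aug_modelχ p, modelχ_nonempty_cyclotomeMod p hl, modelχ_nonempty_cyclotomeTower p hl one_mem cofinal total⟩

end SettingModel

end Literature.AnabelianGeometry.EtaleTheta

end
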